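import Summits.BirchSwinnertonDyer.BirchSwinnertonDyer.Theorems.ManinLocalTwoThreeTameTwoIVVeluB
import Summits.BirchSwinnertonDyer.BirchSwinnertonDyer.Theorems.ManinLocalTwoThreeNoDoublingIVstarFourP
import Literature.NumberTheory.EllipticCurves.AnalyticIsogenyDescentProofs
import Literature.NumberTheory.EllipticCurves.IsogenyDualProofs
import Literature.NumberTheory.EllipticCurves.IsogenyVariableChangeProofs
import Literature.NumberTheory.EllipticCurves.CuspFormLFunctionLevelConductorProofs
import Literature.NumberTheory.EllipticCurves.ModularCurveManinSemistableBridgeProofs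
import HarnessLib

/-!
# The globally minimal carrier of the Vélu `2`-pair is `ℚ`-ISOGENOUS to `W`; E-an-120 at `2` in full under modularity
# (`IV → IV*` with Néron scalar `u = 1`, `IV* → IV` with `u = 2`)

Summit `BirchSwinnertonDyer`, route `ManinLocalTwoThree` (cell bsd-f2-manin), deciding crux C2 `ManinOddAtFour`
(stmt-BirchSwinnertonDyer-22967).  Sequel of `…VeluTwoDiscriminant` (p646201), `…TameTwoIVstarVeluB` (p646508), `…TameTwoIVVeluB`.

* `exists_isIsogenous_dvd_two_velu_two` — the dichotomy `k ∣ 2` of p646201 WITH THE ISOGENY: for any globally minimal `W/ℚ` and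
  rational `2`-torsion abscissa `q` there are a globally minimal `W′`, `ℚ`-ISOGENOUS to `W` (analytic descent
  `isIsogenous_of_forall_mul_mem_lattice`: `Λ_W ⊆ Λ_W + ℤz₀ = Λ_V`), and `k ∣ 2` with `k⁴c₄(W′), k⁶c₆(W′)` = the Vélu `2`-pair and
  the every-prime bookkeeping `ord_p Δ_min(W′) + 3·ord_p B + 12·ord_p k = 2·ord_p Δ_min(W)`.
* `exists_isIsogenous_velu_two_of_IV` — **E-an-120 (`IV`):** `4 ∥ N`, `ord₂ Δ_min = 4` ⟹ an isogenous globally minimal `W′` carries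
  the `u = 1` pair and has `ord₂ Δ_min(W′) = 8` (unconditional).
* `exists_isIsogenous_two_velu_two_of_IVstar_of_tame` — **E-an-120 (`IV*`):** `4 ∥ N`, `ord₂ Δ_min = 8`, and the isogeny class of
  `W` stays tame at `2` (`4 ∥ N(W′)` for every `W′ ∼ W` — conductor invariance) ⟹ an isogenous globally minimal `W′` carries the pair
  divided by `(2⁴, 2⁶)` (Néron scalar `u = 2`) and has `ord₂ Δ_min(W′) = 4`; `…_of_isNewformOf` — the same granted the Modularity
  Theorem `exists_isNewformOf` (the crux's hypothesis) and a newform of `W` (`IsNewformOf.of_isIsogenous` + strong multiplicity one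
  give `N(W′) = N(W)`).

HONEST FRAMING: C2, Manin's conjecture and BSD are not proved.  No definitions, no named facts, no sorry.
References: [SilvermanAEC2009] VI.4.1, VI.5.3, III.6.1; [SilvermanATAEC1994] IV.9.4 Table 4.1; [AtkinLehner1970] Thm. 4;
[DiamondShurman2005] Thm. 8.8.1; [DokchitserDokchitser2015LocalInvariants] Table 1; HOME/MEMO-an.md §67 (E-an-119/120).
-/

set_option autoImplicit false
set_option linter.dupNamespace false

noncomputable section

open scoped Classical
open Polynomial WeierstrassCurve CongruenceSubgroup
open Literature.NumberTheory.EllipticCurves Literature.NumberTheory.EllipticCurves.ModularForms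

namespace Summit.BirchSwinnertonDyer.BirchSwinnertonDyer.Theorems.ManinLocalTwoThree

/-! ### §1 The dichotomy at `2` with the isogeny -/

/-- **The dichotomy at `2` with the isogeny:** for ANY globally minimal `W/ℚ` and `q` with `Ψ₂²_W(q − b₂/12) = 0` there are a globally
minimal `W′` `ℚ`-ISOGENOUS to `W` and `k ∣ 2` with `k⁴c₄(W′) = 720q² − 4c₄`, `k⁶c₆(W′) = 19008q³ − 144c₄q`, and at every prime
`ord_p Δ_min(W′) + 3·ord_p(3q² − c₄/48) + 12·ord_p k = 2·ord_p Δ_min(W)`.  (Proof of p646201's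
`exists_isGloballyMinimal_dvd_two_velu_two`, plus `isIsogenous_of_forall_mul_mem_lattice` on `Λ_W ⊆ Λ_V`.)
[cite: SilvermanAEC2009, Thm. VI.4.1, Thm. VI.5.3, VIII.8.2] [cite: SilvermanATAEC1994, I.1 p.13] -/
theorem exists_isIsogenous_dvd_two_velu_two (W : WeierstrassCurve ℚ) [W.IsElliptic] [W.IsGloballyMinimal]
    (q : ℚ) (hq : W.Ψ₂Sq.eval (q - W.b₂ / 12) = 0) :
    ∃ (W' : WeierstrassCurve ℚ) (k : ℤ) (_ : W'.IsElliptic) (_ : W'.IsGloballyMinimal), IsIsogenous W W' ∧ k ∣ 2 ∧ k ≠ 0 ∧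
      (k : ℚ) ^ 4 * W'.c₄ = 720 * q ^ 2 - 4 * W.c₄ ∧ (k : ℚ) ^ 6 * W'.c₆ = 19008 * q ^ 3 - 144 * W.c₄ * q ∧
      ∀ (p : ℕ) [Fact p.Prime], (padicValInt p W'.minimalDiscriminantInt : ℤ) +
        3 * padicValRat p (3 * q ^ 2 - W.c₄ / 48) + 12 * (padicValInt p k : ℤ) = 2 * padicValInt p W.minimalDiscriminantInt := by
  set A : ℚ := 720 * q ^ 2 - 4 * W.c₄ with hA
  set Bv : ℚ := 19008 * q ^ 3 - 144 * W.c₄ * q with hBv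
  set Bq : ℚ := 3 * q ^ 2 - W.c₄ / 48 with hBq
  set V : WeierstrassCurve ℚ := ⟨0, 0, 0, -A / 48, -Bv / 864⟩ with hV
  have hV4 : V.c₄ = A := by simp only [hV, WeierstrassCurve.c₄, WeierstrassCurve.b₂, WeierstrassCurve.b₄]; ring
  have hV6 : V.c₆ = Bv := by
    simp only [hV, WeierstrassCurve.c₆, WeierstrassCurve.b₂, WeierstrassCurve.b₄, WeierstrassCurve.b₆]; ring
  haveI hVell : V.IsElliptic := ⟨isUnit_iff_ne_zero.mpr (velu_two_Δ_ne_zero W q hq V hV4 hV6)⟩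
  obtain ⟨C, hC⟩ := WeierstrassCurve.hasGlobalMinimalModel_rat_holds V
  haveI := hC
  set u : ℚ := (C.u : ℚ) with hu
  have hu0 : u ≠ 0 := C.u.ne_zero
  have hW'4 : (C • V).c₄ = (u ^ 4)⁻¹ * A := by rw [variableChange_c₄, hV4, Units.val_inv_eq_inv_val, inv_pow]
  have hW'6 : (C • V).c₆ = (u ^ 6)⁻¹ * Bv := by rw [variableChange_c₆, hV6, Units.val_inv_eq_inv_val, inv_pow]
  haveI : (V.baseChange ℂ).IsElliptic := by rw [WeierstrassCurve.baseChange]; infer_instance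
  haveI : (W.baseChange ℂ).IsElliptic := by rw [WeierstrassCurve.baseChange]; infer_instance
  haveI : ((C • V).baseChange ℂ).IsElliptic := by rw [WeierstrassCurve.baseChange]; infer_instance
  obtain ⟨L₀, hL₀⟩ := exists_isNeronLatticeOf_holds (W.baseChange ℂ)
  obtain ⟨LV, hLV⟩ := exists_isNeronLatticeOf_holds (V.baseChange ℂ)
  obtain ⟨L', hL'⟩ := exists_isNeronLatticeOf_holds ((C • V).baseChange ℂ)
  have hΛ' : L'.lattice = (LV.mulLeft ((C.u : ℚ) : ℂ) (by exact_mod_cast C.u.ne_zero)).lattice :=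
    IsNeronLatticeOf.lattice_eq_mulLeft_of_smul C hLV hL'
  obtain ⟨z₀, hz₀, hx₀, h2⟩ := exists_half_period_of_Ψ₂Sq_root W hL₀ q hq
  have hc₄W : (W.baseChange ℂ).c₄ = (W.c₄ : ℂ) := by simp [WeierstrassCurve.baseChange, WeierstrassCurve.map_c₄]
  have hc₄V : (V.baseChange ℂ).c₄ = (V.c₄ : ℂ) := by simp [WeierstrassCurve.baseChange, WeierstrassCurve.map_c₄]
  have hc₆V : (V.baseChange ℂ).c₆ = (V.c₆ : ℂ) := by simp [WeierstrassCurve.baseChange, WeierstrassCurve.map_c₆]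
  have hB : ((Bq : ℚ) : ℂ) = 3 * L₀.weierstrassP z₀ ^ 2 - L₀.g₂ / 4 := by
    rw [hx₀, hL₀.1, hc₄W, hBq]; push_cast; ring
  have hB0 : ((Bq : ℚ) : ℂ) ≠ 0 := by exact_mod_cast velu_two_B_ne_zero W q hq
  have h₂ : LV.g₂ = 12 * L₀.weierstrassP z₀ ^ 2 + 16 * ((Bq : ℚ) : ℂ) := by
    rw [hLV.1, hc₄V, hV4, hx₀, hA, hBq]; push_cast; ring
  have h₃ : LV.g₃ = -8 * L₀.weierstrassP z₀ ^ 3 + 32 * ((Bq : ℚ) : ℂ) * L₀.weierstrassP z₀ := by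
    rw [hLV.2, hc₆V, hV6, hx₀, hBv, hBq]; push_cast; ring
  obtain ⟨hle, -, hidx⟩ := L₀.lattice_eq_of_velu_invariants hz₀ h2 hB hB0 LV h₂ h₃
  -- THE ISOGENY `W ∼ V ∼ C • V` (analytic descent on `Λ_W ⊆ Λ_V`)
  have hisoV : IsIsogenous W V :=
    isIsogenous_of_forall_mul_mem_lattice hL₀.1 hL₀.2 hLV.1 hLV.2 (c := 1) one_ne_zero
      (fun z hz ↦ by rw [Rat.cast_one, one_mul]; exact hle hz)
  have hiso : IsIsogenous W (C • V) := hisoV.trans' (isIsogenous_smul V C)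
  -- the Néron scaling divides 2
  have hu0' : (u : ℂ) ≠ 0 := by exact_mod_cast hu0
  have h2mul : ∀ w : ℂ, w ∈ L₀.lattice → 2 * w ∈ L₀.lattice := fun w hw ↦ by
    have e : (2 : ℂ) * w = w + w := by ring
    rw [e]; exact add_mem hw hw
  have h2v : ∀ v : ℂ, v ∈ LV.lattice → 2 * v ∈ L₀.lattice := fun v hv ↦ by
    rcases hidx v hv with h | h
    · exact h2mul v h
    · have e : (2 : ℂ) * v = 2 * (v - z₀) + 2 * z₀ := by ring
      rw [e]; exact add_mem (h2mul _ h) h2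
  have hμ : ∀ y ∈ L₀.lattice, ((u : ℚ) : ℂ) * y ∈ L'.lattice := fun y hy ↦ by
    rw [hΛ']; exact PeriodPair.mul_mem_mulLeft_lattice.mpr (hle hy)
  have hnμ : ∀ z ∈ L'.lattice, ∃ y ∈ L₀.lattice, ((2 : ℤ) : ℂ) * z = ((u : ℚ) : ℂ) * y := fun z hz ↦ by
    rw [hΛ', PeriodPair.mem_mulLeft_lattice] at hz
    refine ⟨2 * (((u : ℚ) : ℂ)⁻¹ * z), h2v _ hz, ?_⟩
    field_simp
    push_cast; ring
  obtain ⟨k, hk, hk2⟩ :=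
    exists_int_eq_and_dvd_of_neronScaling W (C • V) L₀ L' hL₀ hL' u (n := 2) two_ne_zero hμ hnμ
  have hk0 : k ≠ 0 := by rintro rfl; norm_num at hk2
  refine ⟨C • V, k, inferInstance, hC, hiso, hk2, hk0, ?_, ?_, fun p _ ↦ ?_⟩
  · rw [hW'4, hk]; field_simp
  · rw [hW'6, hk]; field_simp
  have hkQ : (k : ℚ) ≠ 0 := by exact_mod_cast hk0
  set C' : VariableChange ℚ := ⟨Units.mk0 ((k : ℚ)⁻¹) (inv_ne_zero hkQ), 0, 0, 0⟩ with hC'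
  have hu' : ((C'.u⁻¹ : ℚˣ) : ℚ) = k := by rw [Units.val_inv_eq_inv_val, hC', Units.val_mk0, inv_inv]
  have h4' : (k : ℚ) ^ 4 * (C • V).c₄ = A := by rw [hW'4, hk]; field_simp
  have h6' : (k : ℚ) ^ 6 * (C • V).c₆ = Bv := by rw [hW'6, hk]; field_simp
  have hS4 : (C' • (C • V)).c₄ = 720 * q ^ 2 - 4 * W.c₄ := by rw [variableChange_c₄, hu', h4']
  have hS6 : (C' • (C • V)).c₆ = 19008 * q ^ 3 - 144 * W.c₄ * q := by rw [variableChange_c₆, hu', h6']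
  have hSΔ : (C' • (C • V)).Δ = (k : ℚ) ^ 12 * ((C • V).minimalDiscriminantInt : ℚ) := by
    rw [variableChange_Δ, hu', cast_minimalDiscriminantInt]
  have hv := padicValRat_velu_two_Δ p W q hq (C' • (C • V)) hS4 hS6
  have hm0 : ((C • V).minimalDiscriminantInt : ℚ) ≠ 0 := by exact_mod_cast minimalDiscriminantInt_ne_zero (C • V)
  rw [hSΔ, padicValRat.mul (pow_ne_zero _ hkQ) hm0, padicValRat.pow (k : ℚ), ← cast_minimalDiscriminantInt W] at hv
  simp only [padicValRat.of_int] at hv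
  push_cast at hv
  linarith

/-! ### §2 E-an-120 at `2`: `IV → IV*` with `u = 1`; `IV* → IV` with `u = 2` under conductor invariance -/

/-- **E-an-120 (`IV`), with the isogeny:** `W` globally minimal, `4 ∥ N`, `ord₂ Δ_min = 4`, `Ψ₂²(q − b₂/12) = 0` ⟹ a globally minimal
`W′` `ℚ`-isogenous to `W` carries the `u = 1` Vélu `2`-pair and has `ord₂ Δ_min(W′) = 8` (type `IV*` if tame).
[cite: SilvermanATAEC1994, IV.9.4 Table 4.1] [cite: DokchitserDokchitser2015LocalInvariants, Table 1] -/
theorem exists_isIsogenous_velu_two_of_IV (W : WeierstrassCurve ℚ) [W.IsElliptic] [W.IsGloballyMinimal]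
    (h4 : 2 ^ 2 ∣ W.conductorNorm ℤ) (h8 : ¬ 2 ^ 3 ∣ W.conductorNorm ℤ)
    (hΔ4 : padicValInt 2 W.minimalDiscriminantInt = 4) (q : ℚ) (hq : W.Ψ₂Sq.eval (q - W.b₂ / 12) = 0) :
    ∃ (W' : WeierstrassCurve ℚ) (_ : W'.IsElliptic) (_ : W'.IsGloballyMinimal), IsIsogenous W W' ∧
      W'.c₄ = 720 * q ^ 2 - 4 * W.c₄ ∧ W'.c₆ = 19008 * q ^ 3 - 144 * W.c₄ * q ∧
      padicValInt 2 W'.minimalDiscriminantInt = 8 := by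
  haveI : Fact (Nat.Prime 2) := ⟨Nat.prime_two⟩
  have hB := padicValRat_veluB_eq_zero_of_IV W h4 h8 hΔ4 q hq
  obtain ⟨W', k, hE', hM', hiso, hk, hk0, h4', h6', hbook⟩ := exists_isIsogenous_dvd_two_velu_two W q hq
  haveI := hE'; haveI := hM'
  have hb := hbook 2
  rw [hB, hΔ4] at hb
  push_cast at hb
  have h0 : (0 : ℤ) ≤ padicValInt 2 W'.minimalDiscriminantInt := by positivity
  have hk1 : k = 1 ∨ k = -1 := by
    have hk2 : k.natAbs ≤ 2 := by simpa using Nat.le_of_dvd two_pos (Int.natAbs_dvd_natAbs.mpr hk)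
    have hlo : -2 ≤ k := by omega
    have hhi : k ≤ 2 := by omega
    have hv2 : padicValInt 2 2 = 1 := padicValInt_self
    have hv2' : padicValInt 2 (-2) = 1 := by
      rw [show padicValInt 2 (-2) = padicValInt 2 2 from by simp [padicValInt]]; exact padicValInt_self
    interval_cases k
    · exfalso; rw [hv2'] at hb; push_cast at hb; omega
    · exact Or.inr rfl
    · exact absurd rfl hk0
    · exact Or.inl rfl
    · exfalso; rw [hv2] at hb; push_cast at hb; omega
  have hk4 : (k : ℚ) ^ 4 = 1 := by rcases hk1 with rfl | rfl <;> norm_num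
  have hk6 : (k : ℚ) ^ 6 = 1 := by rcases hk1 with rfl | rfl <;> norm_num
  rw [hk4, one_mul] at h4'
  rw [hk6, one_mul] at h6'
  exact ⟨W', hE', hM', hiso, h4', h6', (exists_isGloballyMinimal_velu_two_of_IV W h4 h8 hΔ4 q hq).2 W' h4' h6'⟩

/-- **E-an-120 (`IV*`) under conductor invariance at `2`:** `W` globally minimal, `4 ∥ N`, `ord₂ Δ_min = 8`, `Ψ₂²(q − b₂/12) = 0`, and
every globally minimal curve `ℚ`-isogenous to `W` again has `4 ∥ N` ⟹ a globally minimal `W′ ∼ W` carries the Vélu `2`-pair DIVIDED BY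
`(2⁴, 2⁶)` (Néron scalar `u = 2`) and has `ord₂ Δ_min(W′) = 4` (type `IV`).  (The `u = 1` alternative would have `ord₂ Δ_min = 16`.)
[cite: SilvermanATAEC1994, IV.9.4 Table 4.1] [cite: DokchitserDokchitser2015LocalInvariants, Table 1] -/
theorem exists_isIsogenous_two_velu_two_of_IVstar_of_tame (W : WeierstrassCurve ℚ) [W.IsElliptic] [W.IsGloballyMinimal]
    (h4 : 2 ^ 2 ∣ W.conductorNorm ℤ) (h8 : ¬ 2 ^ 3 ∣ W.conductorNorm ℤ)
    (hΔ8 : padicValInt 2 W.minimalDiscriminantInt = 8) (q : ℚ) (hq : W.Ψ₂Sq.eval (q - W.b₂ / 12) = 0)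
    (htame : ∀ (W' : WeierstrassCurve ℚ) [W'.IsElliptic] [W'.IsGloballyMinimal], IsIsogenous W W' →
      2 ^ 2 ∣ W'.conductorNorm ℤ ∧ ¬ 2 ^ 3 ∣ W'.conductorNorm ℤ) :
    ∃ (W' : WeierstrassCurve ℚ) (_ : W'.IsElliptic) (_ : W'.IsGloballyMinimal), IsIsogenous W W' ∧
      (2 : ℚ) ^ 4 * W'.c₄ = 720 * q ^ 2 - 4 * W.c₄ ∧ (2 : ℚ) ^ 6 * W'.c₆ = 19008 * q ^ 3 - 144 * W.c₄ * q ∧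
      padicValInt 2 W'.minimalDiscriminantInt = 4 := by
  haveI : Fact (Nat.Prime 2) := ⟨Nat.prime_two⟩
  obtain ⟨W', k, hE', hM', hiso, hk, hk0, h4', h6', -⟩ := exists_isIsogenous_dvd_two_velu_two W q hq
  haveI := hE'; haveI := hM'
  obtain ⟨h4W', h8W'⟩ := htame W' hiso
  -- `k = ±2`: `k = ±1` would make `W′` a `u = 1` carrier, `ord₂ Δ_min(W′) = 16`, not tame
  have hk2 : k = 2 ∨ k = -2 := by
    have hk2 : k.natAbs ≤ 2 := by simpa using Nat.le_of_dvd two_pos (Int.natAbs_dvd_natAbs.mpr hk)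
    have hlo : -2 ≤ k := by omega
    have hhi : k ≤ 2 := by omega
    have hone : (k : ℚ) ^ 4 = 1 → (k : ℚ) ^ 6 = 1 → False := fun e4 e6 ↦ by
      rw [e4, one_mul] at h4'
      rw [e6, one_mul] at h6'
      have h16 := padicValInt_minimalDiscriminantInt_eq_sixteen_of_velu_two_of_IVstar W h4 h8 hΔ8 q hq W' h4' h6'
      rcases padicValInt_minimalDiscriminantInt_eq_four_or_eight_of_tame_two W' h4W' h8W' with h | h <;> omega
    interval_cases k
    · exact Or.inr rfl
    · exact (hone (by norm_num) (by norm_num)).elim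
    · exact absurd rfl hk0
    · exact (hone (by norm_num) (by norm_num)).elim
    · exact Or.inl rfl
  have hk4 : (k : ℚ) ^ 4 = 2 ^ 4 := by rcases hk2 with rfl | rfl <;> norm_num
  have hk6 : (k : ℚ) ^ 6 = 2 ^ 6 := by rcases hk2 with rfl | rfl <;> norm_num
  rw [hk4] at h4'
  rw [hk6] at h6'
  exact ⟨W', hE', hM', hiso, h4', h6',
    padicValInt_minimalDiscriminantInt_eq_four_of_two_velu_two_of_IVstar W h4 h8 hΔ8 q hq W' h4' h6'⟩

/-- **E-an-120 (`IV*`) granted modularity:** with the Modularity Theorem `exists_isNewformOf` (the crux's hypothesis) and a newform `f` of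
`W` on `Γ₀(N)`, every curve isogenous to `W` has conductor `N` (`IsNewformOf.of_isIsogenous`, strong multiplicity one); so on the tame
`IV*` stratum the Vélu `2`-isogeny has Néron scalar `u = 2` at `2` and a type-`IV` target.
[cite: AtkinLehner1970, Thm. 4] [cite: DiamondShurman2005, Thm. 8.8.1] [cite: SilvermanATAEC1994, IV.9.4 Table 4.1] -/
theorem exists_isIsogenous_two_velu_two_of_IVstar_of_isNewformOf (hnf : exists_isNewformOf) (W : WeierstrassCurve ℚ)
    [W.IsElliptic] [W.IsGloballyMinimal] {N : ℕ} [NeZero N] {f : CuspForm (Gamma0 N) 2} (hf : IsNewformOf W f)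
    (h4 : 2 ^ 2 ∣ N) (h8 : ¬ 2 ^ 3 ∣ N) (hΔ8 : padicValInt 2 W.minimalDiscriminantInt = 8) (q : ℚ)
    (hq : W.Ψ₂Sq.eval (q - W.b₂ / 12) = 0) :
    ∃ (W' : WeierstrassCurve ℚ) (_ : W'.IsElliptic) (_ : W'.IsGloballyMinimal), IsIsogenous W W' ∧
      (2 : ℚ) ^ 4 * W'.c₄ = 720 * q ^ 2 - 4 * W.c₄ ∧ (2 : ℚ) ^ 6 * W'.c₆ = 19008 * q ^ 3 - 144 * W.c₄ * q ∧
      padicValInt 2 W'.minimalDiscriminantInt = 4 := by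
  have hN : N = W.conductorNorm ℤ := IsNewformOf.level_eq_conductorNorm_of_exists_isNewformOf hnf hf
  refine exists_isIsogenous_two_velu_two_of_IVstar_of_tame W (hN ▸ h4) (hN ▸ h8) hΔ8 q hq fun W' hE hM hiso ↦ ?_
  haveI := hE; haveI := hM
  have hN' : N = W'.conductorNorm ℤ :=
    IsNewformOf.level_eq_conductorNorm_of_exists_isNewformOf hnf (hf.of_isIsogenous hiso.symm_of_charZero)
  exact ⟨hN' ▸ h4, hN' ▸ h8⟩

end Summit.BirchSwinnertonDyer.BirchSwinnertonDyer.Theorems.ManinLocalTwoThree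

end
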